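import Summits.AtomisticToContinuum.HydrodynamicLimit.Theorems.OneFlightGossipEngineEnergyCurrentTailsFirstPartnerObjects
import Literature.MathematicalPhysics.KineticTheory.HardSphereTwoTimePressure
import HarnessLib

/-!
# The anchored one-look-ahead mixing-rate floor from the first-partner floor, the realised share and the
# pathwise transfer — glue G1 (stub `stub_windowMixingRateFloor_of_firstPartner`, line `quartic-schur-ledger`,
# crux `EnergyCurrentTails`, stmt-AtomisticToContinuum-9235; seat c6 reshape B)

Registered glue stub `T′ → I′ → P → W′` of the lead's skeleton `Cruxes/EnergyCurrentTails/Lines/quartic_schur_ledger.lean`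
(objects `…Theorems.EnergyCurrentTailsFirstPartner`): from the MESOSCOPIC FIRST-PARTNER FLOOR T′
(`FirstPartnerFloorMeso`: for every look-ahead ratio `τ₁ ≤ τ₀`, `cνΔ·E[fast] ≤ E[firstPartnerSum]` at `Δ = τ₁h_N`), the
REALISED SHARE I′ (`FirstPartnerRealisedShare`: `E[firstPartnerSum] ≤ A·E[realisedFirstSum]` for `Δ ≤ τ₀h_N`) and the
sure PATHWISE TRANSFER P (`FirstPartnerPathwise`: `ofReal(realisedFirstSum) ≤ mixingFlux` on the good set), the anchored
one-look-ahead rate floor W′ (`WindowMixingRateFloorOne`) follows by a plain chain at the look-ahead ratio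
`τ₁ := min τ₀ᵀ (min τ₀ᴵ (1/4))`:
`cνΔ·E[fast(a)] ≤ E[firstPartnerSum] ≤ A·E[realisedFirstSum] ≤ A·E[mixingFlux (a, a+Δ]]`
(P integrated with `lintegral_mono_ae` over the good set), i.e. W′ with the constant `c/A`.
Constants: `σ₀ := min σ₀ᵀ (min σ₀ᴵ (1/2))`, `K₀ := K₀ᵀ`, `N₀ := max N₀ᵀ N₀ᴵ`.  No finiteness, no absorption.
References: elementary (`ℝ≥0∞` arithmetic).
-/

noncomputable section

open MeasureTheory Set Filter
open scoped ENNReal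

open Literature.Analysis.FluidPDE Literature.MathematicalPhysics.KineticTheory


namespace Summit.AtomisticToContinuum.HydrodynamicLimit.Theorems.QuarticSchurLedger

open Summit.AtomisticToContinuum.HydrodynamicLimit.Theorems.EnergyCurrentTailsFirstPartner

/-- **Glue G1 — the anchored one-look-ahead mixing-rate floor W′ from T′, I′, P** (registered stub
`stub_windowMixingRateFloor_of_firstPartner` of the line `quartic-schur-ledger`, crux stmt-AtomisticToContinuum-9235,
seat c6 reshape B): at the look-ahead ratio `τ₁ = min τ₀ᵀ (min τ₀ᴵ (1/4))`,
`cνΔ·E[fast(a)] ≤ E[firstPartnerSum] ≤ A·E[realisedFirstSum] ≤ A·E[mixingFlux (a, a+Δ]]`, whence W′ with `c/A`. -/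
theorem stub_windowMixingRateFloor_of_firstPartner :
    FirstPartnerFloorMeso → FirstPartnerRealisedShare → FirstPartnerPathwise → WindowMixingRateFloorOne := by
  intro hT hI hP a₀ θ₀ u₀ ha hθ hu ha0 hθ0
  obtain ⟨σT, hσT, HT⟩ := hT a₀ θ₀ u₀ ha hθ hu ha0 hθ0
  obtain ⟨σI, hσI, HI⟩ := hI a₀ θ₀ u₀ ha hθ hu ha0 hθ0
  refine ⟨min σT (min σI (1 / 2)), by positivity, ?_⟩
  intro σ hσ hσ0 T hT0 Φ
  have hσT' : σ < σT := hσ0.trans_le (min_le_left _ _)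
  have hσI' : σ < σI := hσ0.trans_le ((min_le_right _ _).trans (min_le_left _ _))
  have hσh : σ < 1 / 2 := hσ0.trans_le ((min_le_right _ _).trans (min_le_right _ _))
  obtain ⟨K₀, hK₀, K₁, τT, hτT, HT1⟩ := HT σ hσ hσT' T hT0 Φ
  obtain ⟨τI, hτI, A, hA, NI, HI1⟩ := HI σ hσ hσI' T hT0 Φ K₀ K₁
  have hτ₁pos : 0 < min τT (min τI (1 / 4)) := lt_min hτT (lt_min hτI (by norm_num))
  obtain ⟨c, hc, NT, HT2⟩ := HT1 (min τT (min τI (1 / 4))) hτ₁pos (min_le_left _ _)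
  have hA0 : 0 < A := lt_of_lt_of_le one_pos hA
  refine ⟨K₀, hK₀, min τT (min τI (1 / 4)), hτ₁pos, (min_le_right _ _).trans (min_le_right _ _),
    c / A, by positivity, max NT NI, ?_⟩
  intro N hN a ha0 haT
  have hNT : NT ≤ N := (le_max_left _ _).trans hN
  have hNI : NI ≤ N := (le_max_right _ _).trans hN
  have hh : 0 < ((N : ℝ) + 1) ^ (-(1 / 3 : ℝ)) := Real.rpow_pos_of_pos (by positivity) _
  have hΔ : 0 < min τT (min τI (1 / 4)) * ((N : ℝ) + 1) ^ (-(1 / 3 : ℝ)) := mul_pos hτ₁pos hh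
  have hΔI : min τT (min τI (1 / 4)) * ((N : ℝ) + 1) ^ (-(1 / 3 : ℝ)) ≤
      τI * ((N : ℝ) + 1) ^ (-(1 / 3 : ℝ)) :=
    mul_le_mul_of_nonneg_right ((min_le_right _ _).trans (min_le_left _ _)) hh.le
  have haT' : a ≤ T := by linarith
  -- T′ at the anchor, I′ on the look-ahead, P a.e.
  have h1 := HT2 N hNT a ha0 haT'
  have h2 := HI1 N hNI _ hΔ hΔI a ha0 haT
  have h3 : (∫⁻ z, ENNReal.ofReal (realisedFirstSum (hsDiameter σ N)
        (min τT (min τI (1 / 4)) * ((N : ℝ) + 1) ^ (-(1 / 3 : ℝ))) (fun u => (Φ N).flow u z) a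
        (mixMark N K₀ K₁)) ∂(localGibbsLaw σ a₀ u₀ θ₀ N (Φ N))) ≤
      ∫⁻ z, mixingFlux (Φ N) K₀
        (Set.Ioc a (a + min τT (min τI (1 / 4)) * ((N : ℝ) + 1) ^ (-(1 / 3 : ℝ)))) z
        ∂(localGibbsLaw σ a₀ u₀ θ₀ N (Φ N)) := by
    refine lintegral_mono_ae ?_
    filter_upwards [ae_mem_good_localGibbsLaw σ a₀ u₀ θ₀ N (Φ N)] with z hz
    exact hP σ hσ hσh N (Φ N) z hz K₀ K₁ a _ hΔ
  have key := h1.trans (h2.trans (mul_le_mul_right h3 _))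
  -- divide by `A`
  have hsplit : c / A * (σ ^ 2 * ((N + 1 : ℕ) : ℝ) ^ ((1 : ℝ) / 3)) *
      (min τT (min τI (1 / 4)) * ((N : ℝ) + 1) ^ (-(1 / 3 : ℝ))) =
      A⁻¹ * (c * (σ ^ 2 * ((N + 1 : ℕ) : ℝ) ^ ((1 : ℝ) / 3)) *
        (min τT (min τI (1 / 4)) * ((N : ℝ) + 1) ^ (-(1 / 3 : ℝ)))) := by ring
  rw [hsplit, ENNReal.ofReal_mul (inv_nonneg.2 hA0.le), mul_assoc]
  refine (mul_le_mul_right key _).trans ?_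
  rw [← mul_assoc, ← ENNReal.ofReal_mul (inv_nonneg.2 hA0.le), inv_mul_cancel₀ hA0.ne',
    ENNReal.ofReal_one, one_mul]

end Summit.AtomisticToContinuum.HydrodynamicLimit.Theorems.QuarticSchurLedger

end
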